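import Summits.BirchSwinnertonDyer.BirchSwinnertonDyer.Theorems.ErratumRoadFiveIMCDivClassicalBLambdaMatchingFromFacts
import HarnessLib

/-!
# Route `ErratumRoadFive` (K2), crux `OpenInputNotRam` (item 19282), REGISTERED skeleton v3B
# (`Cruxes/OpenInputNotRam/Lines/birth.lean`, plan g31 08:07Z, 0685c8cef1f0): the registered stub
# `stub_imcDivSomeFrameNotRamB` (the oriented value-free atom on the (¬ram) pairs) ⟸ ROAD B12's two open shapes
# UB|¬ram and INV|¬ram + the two refereed named facts — BY NAME, signature VERBATIM

Cell `bsd-stepL` (run/shared/lean/pub/bsd-stepL/), seat `bsd-stepL-bdp` (prover g18, 2026-08-27).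
`--supports stmt-BirchSwinnertonDyer-19282 --as helper`. THEOREMS ONLY (no definition, no named fact, no `sorry`).
Memo: HOME/proof/PROOF-BDP.md §37 (ROAD B12), §38–§40 (bricks (ε3), (ε2-an) at p ∥ N; census 38.4).

What this file adds to p512577 (`P2.imcDivSomeFrameOnTreeB_of_hsieh2014_of_bdp2013_of_ratUpperBound_of_invariantsMatch`,
the FRAME-free composition at ONE pair `(W, p)`): the ∀-pair, (¬ram)-restricted version whose conclusion is the
REGISTERED stub `Cruxes.OpenInputNotRam.Birth.stub_imcDivSomeFrameNotRamB` VERBATIM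
(`∀ W p, ¬ Ram W p → P2.IMCDivSomeFrameOnTreeB W p`), from hypotheses UB ∕ INV that carry the SAME extra binder
`¬ Ram W p` — so the registered stub's residual along ROAD B12 is, by name, exactly {UB|¬ram, INV|¬ram} (plus
the two PUB facts Hsieh 2014 Thm 5.6 ∕ BDP13 Thm 5.5 carried by name). With v3B's second composition
`OpenInputNotRam_of_atomB` (PublishedInputsFive + the JIMJ18 fact leaf + this stub ⟹ the crux) the crux 19282
⟸ {PUB facts, UB|¬ram, INV|¬ram}.

HONEST FRAMING: CONDITIONAL theorem; UB|¬ram (brick (ε3): §38.8∕§38.10∕§39 memo-proved at NON-SPLIT p only,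
PRE + gap at split p) and INV|¬ram (bricks (ε1)(ε2)(ε4); partner needs E[p] finite flat at p — 908 of
112 239 class-wide (¬ram) pairs, §38.4) are OPEN shapes, not discharged; nothing booked (T7); BSD is not proved for
any class; X11b stays CONSTRUCTION-SHAPED. NOT Theses-free (imports p512577's module, whose closure holds the
route files) — a helper, not citable inline in `closes`.

References: [Castella2018Erratum] (2.4); [Hsieh2014] Thm. 5.6; [BertoliniDarmonPrasanna2013] Thm. 5.5;
[Washington1997] Prop. 7.2; [EmertonPollackWeston2006] Thm. 1; [BurungaleCastellaSkinner2025] Thm. 1.2.4.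
-/

set_option autoImplicit false
set_option linter.dupNamespace false

noncomputable section

open scoped Classical NumberField

open WeierstrassCurve NumberField IsDedekindDomain Field PowerSeries
open Literature.NumberTheory.EllipticCurves Literature.NumberTheory.EllipticCurves.GreenbergSelmer
open Literature.NumberTheory.EllipticCurves.ModularForms
open Literature.NumberTheory.EllipticCurves.Rank1Residual
open Literature.NumberTheory.EllipticCurves.Castella2018
open Literature.NumberTheory.GaloisRepresentations Literature.NumberTheory.GaloisCohomology
open Summit.BirchSwinnertonDyer.Rank1Residual.X11b.AcSelmer
open Summit.BirchSwinnertonDyer.Rank1Residual.X11b.Halves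
open Summit.BirchSwinnertonDyer.Rank1Residual.X1.KellerYinHalves
open Summit.BirchSwinnertonDyer.Rank1Residual Summit.BirchSwinnertonDyer.Rank1Residual.X11b

namespace Summit.BirchSwinnertonDyer.BirchSwinnertonDyer.Theorems

/-- **The REGISTERED v3B stub `stub_imcDivSomeFrameNotRamB` of crux 19282 ⟸ {Hsieh14 5.6, BDP13 5.5, UB|¬ram,
INV|¬ram}** — signature VERBATIM (`∀ W p, ¬ Ram W p → P2.IMCDivSomeFrameOnTreeB W p`); UB|¬ram ∕ INV|¬ram are
p507771's per-pair shapes universally quantified over `(W, p)` behind the stub's own binder `¬ Ram W p`.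
Proof: p512577 at each pair. CONDITIONAL on all four hypotheses; nothing booked.
[cite: Castella2018Erratum, (2.4) (p. 4) (the atom's display)] [cite: Hsieh2014, Thm. 5.6]
[cite: BertoliniDarmonPrasanna2013, Thm. 5.5] [cite: Washington1997, §7.1 Prop. 7.2 and §13.2] -/
theorem openInputNotRam_stub_imcDivSomeFrameNotRamB_of_facts_of_ratUpperBound_of_invariantsMatch
    (hH : hsieh2014_exists_anticyclotomicPAdicLFunction_unrPeriod)
    (hR : bertoliniDarmonPrasanna2013_centralValue_reciprocity)
    (hUB : ∀ (W : WeierstrassCurve ℚ) [W.IsElliptic] [W.IsGloballyMinimal] (p : ℕ) [Fact p.Prime],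
      ¬ Literature.NumberTheory.EllipticCurves.Rank1Residual.Ram W p →
      ∀ (N : ℕ) [NeZero N] (K : Type) [Field K] [NumberField K]
        (Dt : ModularParametrizationData W N) (H : HeegnerDatum N (NumberField.discr K)) (ι : K →+* ℂ)
        (P : (W.baseChange K).toAffine.Point),
        ClassX11b W p → 5 ≤ p → Surj W p → W.conductorNorm ℤ = N → IsImaginaryQuadratic K →
        Odd (NumberField.discr K) → ¬ (p : ℤ) ∣ NumberField.discr K → ¬ p ∣ Units.torsionOrder K →
        SatisfiesHeegnerHypothesis N K →
        (W.quadraticTwist (NumberField.discr K : ℚ)).entireLFunction 1 ≠ 0 →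
        WeierstrassCurve.Affine.Point.map ι.toRatAlgHom P = heegnerPointComplex Dt H →
        ¬ (p : ℤ) ∣ Dt.c → ¬ IsOfFinAddOrder P →
        ∀ (κ : ZpExtension K p), κ.IsAnticyclotomic →
          ∀ (γ : Field.absoluteGaloisGroup K) [Fact (κ.IsTopGenerator γ)]
            (ι' : PadicAlgCl p ≃+* ℂ) (w₀ : InfinitePlace K) (P' : (W.baseChange K).toAffine.Point),
            WeierstrassCurve.Affine.Point.map w₀.embedding.toRatAlgHom P' = heegnerPointComplex Dt H →
            ∀ (e : K →+* ℚ_[p]),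
              (∀ k : 𝓞 K, k ∈ (primeOfEmbeddingDatum p ι' w₀.embedding).asIdeal ↔ ‖e (k : K)‖ < 1) →
              ∀ (ΩK : ℂ) (Ωp : (unrIntegers p)ˣ) (L : UnrSeries p), ΩK ≠ 0 →
                IsBDPLFunction ι' (primeOfEmbeddingDatum p ι' w₀.embedding) κ γ Dt.f ΩK
                  ((Ωp : unrIntegers p) : ℂ_[p]) L →
                ∀ (𝔭bar : HeightOneSpectrum (𝓞 K)), ((p : ℕ) : 𝓞 K) ∈ 𝔭bar.asIdeal →
                  𝔭bar ≠ primeOfEmbeddingDatum p ι' w₀.embedding →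
                  ∃ k : ℕ, C (((p : ℕ) : unrIntegers p) ^ k) * L ∈
                    (XAc.charIdeal (W.baseChange K) p κ 𝔭bar ∅ γ).map (PowerSeries.map (toUnr p)))
    (hINV : ∀ (W : WeierstrassCurve ℚ) [W.IsElliptic] [W.IsGloballyMinimal] (p : ℕ) [Fact p.Prime],
      ¬ Literature.NumberTheory.EllipticCurves.Rank1Residual.Ram W p →
      ∀ (N : ℕ) [NeZero N] (K : Type) [Field K] [NumberField K]
        (Dt : ModularParametrizationData W N) (H : HeegnerDatum N (NumberField.discr K)) (ι : K →+* ℂ)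
        (P : (W.baseChange K).toAffine.Point),
        ClassX11b W p → 5 ≤ p → Surj W p → W.conductorNorm ℤ = N → IsImaginaryQuadratic K →
        Odd (NumberField.discr K) → ¬ (p : ℤ) ∣ NumberField.discr K → ¬ p ∣ Units.torsionOrder K →
        SatisfiesHeegnerHypothesis N K →
        (W.quadraticTwist (NumberField.discr K : ℚ)).entireLFunction 1 ≠ 0 →
        WeierstrassCurve.Affine.Point.map ι.toRatAlgHom P = heegnerPointComplex Dt H →
        ¬ (p : ℤ) ∣ Dt.c → ¬ IsOfFinAddOrder P →
        ∀ (κ : ZpExtension K p), κ.IsAnticyclotomic →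
          ∀ (γ : Field.absoluteGaloisGroup K) [Fact (κ.IsTopGenerator γ)]
            (ι' : PadicAlgCl p ≃+* ℂ) (w₀ : InfinitePlace K) (P' : (W.baseChange K).toAffine.Point),
            WeierstrassCurve.Affine.Point.map w₀.embedding.toRatAlgHom P' = heegnerPointComplex Dt H →
            ∀ (e : K →+* ℚ_[p]),
              (∀ k : 𝓞 K, k ∈ (primeOfEmbeddingDatum p ι' w₀.embedding).asIdeal ↔ ‖e (k : K)‖ < 1) →
              ∀ (ΩK : ℂ) (Ωp : (unrIntegers p)ˣ) (L : UnrSeries p), ΩK ≠ 0 →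
                IsBDPLFunction ι' (primeOfEmbeddingDatum p ι' w₀.embedding) κ γ Dt.f ΩK
                  ((Ωp : unrIntegers p) : ℂ_[p]) L →
                ∀ (𝔭bar : HeightOneSpectrum (𝓞 K)), ((p : ℕ) : 𝓞 K) ∈ 𝔭bar.asIdeal →
                  𝔭bar ≠ primeOfEmbeddingDatum p ι' w₀.embedding →
                  ∃ (g : IwasawaAlgebra p) (n : ℕ),
                    XAc.charIdeal (W.baseChange K) p κ 𝔭bar ∅ γ = Ideal.span {g} ∧
                    (‖((coeff n (PowerSeries.map (toUnr p) g) : unrIntegers p) : ℂ_[p])‖ = 1 ∧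
                      ∀ i < n, ‖((coeff i (PowerSeries.map (toUnr p) g) : unrIntegers p) : ℂ_[p])‖ < 1) ∧
                    (‖((coeff n L : unrIntegers p) : ℂ_[p])‖ = 1 ∧
                      ∀ i < n, ‖((coeff i L : unrIntegers p) : ℂ_[p])‖ < 1)) :
    ∀ (W : WeierstrassCurve ℚ) [W.IsElliptic] [W.IsGloballyMinimal] (p : ℕ) [Fact p.Prime],
      ¬ Literature.NumberTheory.EllipticCurves.Rank1Residual.Ram W p →
        Summit.BirchSwinnertonDyer.Rank1Residual.X11b.P2.IMCDivSomeFrameOnTreeB W p := by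
  intro W _ _ p _ hnr
  exact P2.imcDivSomeFrameOnTreeB_of_hsieh2014_of_bdp2013_of_ratUpperBound_of_invariantsMatch hH hR
    (hUB W p hnr) (hINV W p hnr)

end Summit.BirchSwinnertonDyer.BirchSwinnertonDyer.Theorems

end
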